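/-
Copyright (c) 2026. All rights reserved.
Released under Apache 2.0 license as described in the file LICENSE.
Authors: abc-iut cell, prover seat abc-iut-L4-t5 (gen 10; row «F3757-PORT», abc-iut-L4-lead m147 (5)), after abc-iut-f-101's
`LogFrobeniusMonoTelecoreObservablesOf.lean` (the mono-analytic twin, Cor 5.10 (iv)(b)), over files 1–6 of this mover.
-/
import Literature.AnabelianGeometry.AbsoluteAnabelian.LogFrobeniusAnTelecoreObservablesPush
import Literature.AnabelianGeometry.AbsoluteAnabelian.LogFrobeniusObservablesTelecore
import Literature.AnabelianGeometry.AbsoluteAnabelian.LogFrobeniusLogWallIndependence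
import Literature.AnabelianGeometry.AbsoluteAnabelian.LogFrobeniusShiftActionOfRealises
import Literature.AnabelianGeometry.AbsoluteAnabelian.LogFrobeniusCoresProofs
import Literature.AnabelianGeometry.AbsoluteAnabelian.DiagramSinkSystems
import HarnessLib

/-!
# [AbsTopIII] Cor 5.5 (iii), last sentence, inside `D_{An•}` — SUFFICIENCY (abc-iut-w5-d144's `Cor55ObservablesTelecoreCompatible`)

S. Mochizuki, *Topics in absolute anabelian geometry III: global reconstruction algorithms*,
J. Math. Sci. Univ. Tokyo 22 (2015) 939–1156 [MochizukiAbsTopIII2015]; manuscript `paper:url-5493eb38cbb7`, locators read on the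
page: Cor 5.5 (i) p. 130 (cores, `n = 5, 6`), (ii) pp. 130–131 (the telecore `𝔗_{An•}`), (iii) p. 131 ("the families of
homotopies that constitute `S_log` and `S_log⊞` are compatible with one another as well as with the families of homotopies
that constitute the core and telecore structures of (i), (ii)"); Def 3.5 (ii) p. 75 ("compatible"), (iv) p. 76.

WHAT (row «F3757-PORT», file 8 of the mover; FACT-LIST F-3757 — the An• instance of abc-iut-f-101's sink-system method):
* `an_sink_push` — the push-forward axiom of the sinks of `D_{An•}` (into the cores by file 7's `an_push_lift`; along
  `𝒩⊞_v → 𝒩_v` by `an_push_forget_app`; through a loop `… → An•[𝒳] →φ_⋏ …` by file 4's `anSink_push_outer`; nothing else joins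
  two observation vertices, file 6's pins);
* `anSinkSystem`, `anObsFamily` — the sink system (abc-iut-f-101's `SinkSystem`) and ITS family `K` on `D_{An•}`;
* `anSubFamily_jfam` (`𝒥 ⊆ K`), `e5Family`/`e5Family_isCore`/`compatibleInTelecoreE5` (the core of (i) at `ℰ•` is `K` pulled back,
  all pairs being members at `ℰ•`), `compatibleInTelecorePlus/TS` (the embedded `S_log⊞_v`, `S_log_v` are members);
* ★ `cor55ObservablesTelecoreCompatible_of` — `Cor55ObservablesTelecoreCompatible TS` for every setting with `V(F_mod) ≠ ∅` and
  observables `S_log⊞_v = Hplus v`, `S_log_v = Hts v` (`IsLogObservablePlus/TS`) such that `Hts v ⊇ Hplus v ▷ (𝒩⊞_v → 𝒩_v)`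
  (`hpush`), every homotopy read in `D_{An•}` lies over `Th•[Z]` (`hoverPlus`, `hoverTS`; file 1's PLAIN over-datum `anOverE`), and
  the boundary sets are reflexive on paths into the observation vertex (`hreflPlus`, `hreflTS`).
The instances at the genuine carriers (abc-iut-w5-d144's `logObsFamily`, `logObsFamilyTS`) follow in the next file.

Pure category theory over the typed setting; nothing here bears on [IUTchIII] Cor. 3.12; no side taken.
-/

set_option autoImplicit false

universe u

open CategoryTheory Quiver

namespace Literature.AnabelianGeometry.AbsoluteAnabelian

namespace LogFrobeniusSetting

open DiagramOfCategories

variable {Vmod : Type u} {isArc : Vmod → Bool} (L : LogFrobeniusSetting Vmod isArc)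

/-! ## Bookkeeping -/

/-- Identities of propositionally equal path functors of equal diagrams agree (bookkeeping). [cite: MochizukiAbsTopIII2015, Definition 3.5 (ii) p.75] -/
theorem heq_id_pathFunctor' {W : Type*} [Quiver W] {D₁ D₂ : DiagramOfCategories W} (h : D₁ = D₂) {a b : W} (p : Path a b) :
    HEq (𝟙 (D₁.pathFunctor p) : D₁.pathFunctor p ⟶ D₁.pathFunctor p) (𝟙 (D₂.pathFunctor p) : D₂.pathFunctor p ⟶ D₂.pathFunctor p) := by
  subst h; rfl

/-- Identities of equal functors agree (bookkeeping). [cite: MochizukiAbsTopIII2015, Definition 3.5 (ii) p.75] -/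
theorem heq_id_of_functor_eq {A B : Type*} [Category A] [Category B] {F G : A ⥤ B} (h : F = G) :
    HEq (𝟙 F : F ⟶ F) (𝟙 G : G ⟶ G) := by
  subst h; rfl

/-- A boundary pair, re-typed along equal endpoints and `HEq` paths, is a boundary pair with the same homotopy
(bookkeeping for two presentations of one embedding). [cite: MochizukiAbsTopIII2015, Definition 3.5 (ii) p.75] -/
theorem mem_of_heq {W : Type*} [Quiver W] {D : DiagramOfCategories W} (K : D.HomotopyFamily) {a a' b b' : W} (ha : a = a')
    (hb : b = b') {p q : Path a b} {p' q' : Path a' b'} (hp : HEq p p') (hq : HEq q q') (h : K.E p q) :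
    ∃ h' : K.E p' q', HEq (K.η h) (K.η h') := by
  subst ha hb; cases hp; cases hq; exact ⟨h, HEq.rfl⟩

/-! ## The push-forward axiom, dispatched -/

section Push

variable (Hplus : ∀ v : Vmod, (L.logDiagramPlus v).HomotopyFamily) (Hts : ∀ v : Vmod, (L.logDiagramTS v).HomotopyFamily)
  (hpush : ∀ v : Vmod, SubFamily (pushFamily (Hplus v)) (Hts v))
  (hoverPlus : ∀ (v : Vmod) (a : (logShapePlus (isArc := isArc) v).Vertex)
    (p q : Path a (logShapePlus (isArc := isArc) v).obs) (h : (Hplus v).E p q),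
    L.anOverE.IsOver ((plusEmb (Vmod := Vmod) (isArc := isArc) v).mapPath p) ((plusEmb (Vmod := Vmod) (isArc := isArc) v).mapPath q)
      (L.embPlusHomAn v (Hplus v) h))
  (hoverTS : ∀ (v : Vmod) (a : (logShapeTS (isArc := isArc) v).Vertex)
    (p q : Path a (logShapeTS (isArc := isArc) v).obs) (h : (Hts v).E p q),
    L.anOverE.IsOver ((tsEmb (Vmod := Vmod) (isArc := isArc) v).mapPath p) ((tsEmb (Vmod := Vmod) (isArc := isArc) v).mapPath q)
      (L.embTSHomAn v (Hts v) h))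
  (hreflPlus : ∀ (v : Vmod) {a : (logShapePlus (isArc := isArc) v).Vertex} (p : Path a (logShapePlus (isArc := isArc) v).obs),
    (Hplus v).E p p)
  (hreflTS : ∀ (v : Vmod) {a : (logShapeTS (isArc := isArc) v).Vertex} (p : Path a (logShapeTS (isArc := isArc) v).obs),
    (Hts v).E p p)

include hpush hoverPlus hoverTS hreflPlus hreflTS in
/-- **The push-forward axiom for the sinks of `D_{An•}`** (abc-iut-f-101's `SinkSystem.push`): a member pair at a flagged `n`
followed by a path `s` into a flagged `n'` is a member at `n'` with the post-whiskered homotopy. Into the cores `An•[𝒳]`, `ℰ•`: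
file 6's `an_push_lift`. Into `𝒩⊞_w` / `𝒩_w`: either `s` passes through `An•[𝒳]` and re-enters by a telecore edge — an OUTER
member (file 4's `anSink_push_outer`, the observable part being a reflexive pair) — or `s` stays inside the sub-observable, and
then (file 6's pins) `s` is trivial or `s = [𝒩⊞_w → 𝒩_w]` (`an_push_forget_app`). [cite: MochizukiAbsTopIII2015, Definition 3.5 (iv) p.76] -/
theorem an_sink_push {a n n' : (anShape (Vmod := Vmod) (isArc := isArc)).Vertex} {p q : Path a n}
    (h : (L.anSinkAt Hplus Hts n).E p q) (s : Path n n') (hn' : isObsAn n' = true) :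
    ∃ h' : (L.anSinkAt Hplus Hts n').E (p.comp s) (q.comp s), ∀ x : L.anDiagram.obj a,
      ((L.anSinkAt Hplus Hts n').η h').app x = eqToHom (L.anDiagram.pathFunctor_comp_obj p s x) ≫
        (L.anDiagram.pathFunctor s).map (((L.anSinkAt Hplus Hts n).η h).app x) ≫
          eqToHom (L.anDiagram.pathFunctor_comp_obj q s x).symm := by
  have hθ := L.an_isOver_sinkη Hplus Hts hoverPlus hoverTS h
  rcases n' with ⟨⟨k⟩ | _ | ⟨w⟩ | ⟨w⟩ | _ | _ | _ | ⟨w⟩ | ⟨w⟩ | _ | _ | _, hy⟩ | _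
  · cases hn'
  · cases hn'
  · -- into `𝒩⊞_w`
    rcases exists_inner_or_outer' (DVertex.InFirstRows 2) (.nplus w) inFive_of_inTwo' (nplus_mem_five w) (plus_hcl w) (plus_hxsJ w)
      (obsShape (DVertex.InFirstRows 2) (.nplus w)).obs s with ⟨a₀, r₀, e, hs⟩ | ⟨A, c, hc, j, u, hs⟩
    · subst e
      rcases a₀ with ⟨c, hc⟩ | _
      · rcases c with ⟨k'⟩ | _ | ⟨v⟩ | ⟨v⟩ | _ | _ | _ | ⟨v⟩ | ⟨v⟩ | _ | _ | _
        · exact (h : False).elim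
        · exact (h : False).elim
        · exact absurd hc.2 (by change ¬ (3 ≤ 2); decide)
        · exact absurd hc.2 (by change ¬ (4 ≤ 2); decide)
        · exact absurd hc.2 (by change ¬ (5 ≤ 2); decide)
        · exact (h : False).elim
        · exact (h : False).elim
        · exact (h : False).elim
        · exact (h : False).elim
        · exact (h : False).elim
        · exact (h : False).elim
        · exact (h : False).elim
      · obtain ⟨e, hr⟩ := plusPath_from_obs w r₀
        cases hr
        cases hs
        exact ⟨h, fun x => app_eq_conj_nil_map' _ x (L.anDiagram.pathFunctor_nil _) _ _⟩
    · have hu : (L.plusComapAn w (Hplus w)).E u u := (L.plusComapAn_E_iff w (Hplus w) u u).mpr (hreflPlus w u)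
      obtain ⟨h', e'⟩ := anSink_push_outer (plus_hnot w) _ hθ A c hc j u hu hs
      exact ⟨h', fun x => (NatTrans.congr_app e' x).trans
        (app_conj_whiskerRight _ _ (L.anDiagram.pathFunctor_comp p s) (L.anDiagram.pathFunctor_comp q s) x _ _)⟩
  · -- into `𝒩_w`
    rcases exists_inner_or_outer' (InPortionThree w) (.nv w) (inFive_of_inPortionThree' w) (nv_mem_five w) (ts_hcl w) (ts_hxsJ w)
      (obsShape (InPortionThree w) (.nv w)).obs s with ⟨a₀, r₀, e, hs⟩ | ⟨A, c, hc, j, u, hs⟩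
    · subst e
      rcases a₀ with ⟨c, hc⟩ | _
      · rcases c with ⟨k'⟩ | _ | ⟨v⟩ | ⟨v⟩ | _ | _ | _ | ⟨v⟩ | ⟨v⟩ | _ | _ | _
        · exact (h : False).elim
        · exact (h : False).elim
        · -- from `𝒩⊞_v`, `v = w`: `s = [𝒩⊞_w → 𝒩_w]`
          rcases hc with hc | hc
          · exact absurd hc.2 (by change ¬ (3 ≤ 2); decide)
          · cases hc
            rcases tsPath_from_nplus w r₀ with ⟨e, -⟩ | ⟨-, hr⟩
            · cases e
            · cases hr
              cases hs
              exact L.an_push_forget_app Hplus Hts hpush w h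
        · rcases hc with hc | hc
          · exact absurd hc.2 (by change ¬ (4 ≤ 2); decide)
          · cases hc
        · rcases hc with hc | hc
          · exact absurd hc.2 (by change ¬ (5 ≤ 2); decide)
          · cases hc
        · exact (h : False).elim
        · exact (h : False).elim
        · exact (h : False).elim
        · exact (h : False).elim
        · exact (h : False).elim
        · exact (h : False).elim
        · exact (h : False).elim
      · obtain ⟨e, hr⟩ := tsPath_from_obs w r₀
        cases hr
        cases hs
        exact ⟨h, fun x => app_eq_conj_nil_map' _ x (L.anDiagram.pathFunctor_nil _) _ _⟩
    · have hu : (L.tsComapAn w (Hts w)).E u u := (L.tsComapAn_E_iff w (Hts w) u u).mpr (hreflTS w u)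
      obtain ⟨h', e'⟩ := anSink_push_outer (ts_hnot w) _ hθ A c hc j u hu hs
      exact ⟨h', fun x => (NatTrans.congr_app e' x).trans
        (app_conj_whiskerRight _ _ (L.anDiagram.pathFunctor_comp p s) (L.anDiagram.pathFunctor_comp q s) x _ _)⟩
  · -- into `ℰ•`
    exact ⟨trivial, fun x => L.an_push_lift Hplus Hts hoverPlus hoverTS h s (L.anOverE_ff_e5' hy) x⟩
  · cases hn'
  · cases hn'
  · cases hn'
  · cases hn'
  · cases hn'
  · cases hn'
  · cases hn'
  · -- into `An•[𝒳]`
    exact ⟨trivial, fun x => L.an_push_lift Hplus Hts hoverPlus hoverTS h s L.anOverE_ff_obs x⟩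

/-! ## The sink system of `D_{An•}`, its family `K` -/

/-- **The sink system of `D_{An•}`** (core lifts at `An•[𝒳]` and `ℰ•`; `S_log⊞_v` closed under the telecore loops at `𝒩⊞_v`;
`S_log_v` likewise at `𝒩_v`). [cite: MochizukiAbsTopIII2015, Cor 5.5 (iii) p. 131] -/
noncomputable def anSinkSystem : SinkSystem L.anDiagram isObsAn where
  E := fun _ n p q => (L.anSinkAt Hplus Hts n).E p q
  mem_isObs := fun _ _ _ _ h => L.isObsAn_of_mem Hplus Hts h
  η := fun _ n _ _ h => (L.anSinkAt Hplus Hts n).η h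
  η_self := fun _ _ _ h => L.an_sink_η_self Hplus Hts h
  trans := fun _ _ _ _ _ h₁ h₂ => L.an_sink_trans Hplus Hts h₁ h₂
  precomp := fun _ _ _ _ _ h r => L.an_sink_precomp Hplus Hts h r
  push := fun _ _ _ _ _ h s hn' => L.an_sink_push Hplus Hts hpush hoverPlus hoverTS hreflPlus hreflTS h s hn'

/-- **The family `K` on `D_{An•}`** generated by the sink system. [cite: MochizukiAbsTopIII2015, Cor 5.5 (iii) p. 131] -/
noncomputable def anObsFamily : L.anDiagram.HomotopyFamily :=
  (L.anSinkSystem Hplus Hts hpush hoverPlus hoverTS hreflPlus hreflTS).family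

include hpush hoverPlus hoverTS hreflPlus hreflTS in
/-- **`K` contains the telecore family `𝒥` of `𝔗_{An•}`** (a telecore pair `([γ₃]∘[γ₁], [γ₃]∘[γ₂])` is the member `(γ₁, γ₂)` at
`An•[𝒳]` whiskered by `γ₃`: file 1's `anTelecoreE_Jfam_η` and abc-iut-f-101's `family_η_tail`).
[cite: MochizukiAbsTopIII2015, Definition 3.5 (iv) p.76] -/
theorem anSubFamily_jfam [Nonempty Vmod] :
    SubFamily L.anTelecoreE.Jfam (L.anObsFamily Hplus Hts hpush hoverPlus hoverTS hreflPlus hreflTS) := by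
  intro a b P Q h
  obtain ⟨⟨w, hw, p₁, q₁, s, hP, hQ⟩⟩ := h
  subst hw
  obtain ⟨h', e⟩ := (L.anSinkSystem Hplus Hts hpush hoverPlus hoverTS hreflPlus hreflTS).family_η_tail
    (show (L.anSinkSystem Hplus Hts hpush hoverPlus hoverTS hreflPlus hreflTS).E p₁ q₁ from trivial) s hP hQ
  exact ⟨h', (L.anTelecoreE_Jfam_η ⟨⟨_, rfl, p₁, q₁, s, hP, hQ⟩⟩ p₁ q₁ s hP hQ).trans e.symm⟩

/-! ## The core of (i) at `ℰ•` is `K` pulled back -/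

/-- `K` pulled back to the presentation `D•_{≤4} ∪ {ℰ•}` (abc-iut-L4-t5's `comap`, transported along `extendE5_eq_comapAlongAn`).
[cite: MochizukiAbsTopIII2015, Definition 3.5 (ii) p.75] -/
noncomputable def e5Comap (K : L.anDiagram.HomotopyFamily) :
    ((L.subdiagram (DVertex.InFirstRows 4)).extend (L.obsExt (DVertex.InFirstRows 4) .e5)).HomotopyFamily :=
  L.extendE5_eq_comapAlongAn.symm ▸ K.comap e5Emb

/-- **The core family at `ℰ•`**: `K` pulled back, restricted to the pairs into `ℰ•` (an observable family).
[cite: MochizukiAbsTopIII2015, Cor 5.5 (i) p. 130] -/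
noncomputable def e5Family (K : L.anDiagram.HomotopyFamily) :
    ((L.subdiagram (DVertex.InFirstRows 4)).extend (L.obsExt (DVertex.InFirstRows 4) .e5)).HomotopyFamily :=
  (L.e5Comap K).restrictBoundary
    (fun _ b p q => b = (obsShape (DVertex.InFirstRows (isArc := isArc) 4) DVertex.e5).obs ∧ (L.e5Comap K).E p q)
    ((DiagramOfCategories.isSaturated_endsAt_obs (obsShape (DVertex.InFirstRows (isArc := isArc) 4) DVertex.e5)
      (fun _ => (inferInstance : IsEmpty PEmpty.{u + 1}))).inter (L.e5Comap K).isSaturated)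
    (fun _ _ _ _ h => h.2)

/-- Its boundary pairs end at `ℰ•`. [cite: MochizukiAbsTopIII2015, Definition 3.5 (iii) p.75] -/
theorem e5Family_terminal (K : L.anDiagram.HomotopyFamily) :
    ∀ ⦃a b : (obsShape (DVertex.InFirstRows (isArc := isArc) 4) DVertex.e5).Vertex⦄ ⦃p q : Path a b⦄,
      (L.e5Family K).E p q → b = (obsShape (DVertex.InFirstRows (isArc := isArc) 4) DVertex.e5).obs :=
  fun _ _ _ _ h => h.1

/-- It is compatible with `K` along `embE5`. [cite: MochizukiAbsTopIII2015, Cor 5.5 (iii) p. 131] -/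
theorem compatibleInTelecoreE5 (K : L.anDiagram.HomotopyFamily) : L.CompatibleInTelecoreE5 anJ L.anTel K (L.e5Family K) := by
  intro a b p q h
  obtain ⟨h₁, e₁⟩ := K.cast_comap_compatible e5Emb L.extendE5_eq_comapAlongAn.symm p q h.2
  obtain ⟨h₂, e₂⟩ := mem_of_heq K (embE5_obj_eq a).symm (embE5_obj_eq b).symm (embE5_mapPath_heq p).symm
    (embE5_mapPath_heq q).symm h₁
  exact ⟨h₂, e₁.trans e₂⟩

include hpush hoverPlus hoverTS hreflPlus hreflTS in
/-- **For the family `K` of the sink system it is a CORE** (every co-verticial pair into `ℰ•` is a member at `ℰ•`, hence a boundary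
pair of `K`; every vertex of `D•_{≤4}` reaches `ℰ•`, abc-iut-L4-t10's `reach_e5`). [cite: MochizukiAbsTopIII2015, Cor 5.5 (i) p. 130] -/
theorem e5Family_isCore [Nonempty Vmod] :
    (DiagramOfCategories.Observable.mk _ (fun _ => (inferInstance : IsEmpty PEmpty.{u + 1})) _
      (L.e5Family (L.anObsFamily Hplus Hts hpush hoverPlus hoverTS hreflPlus hreflTS))
      (L.e5Family_terminal _)).IsCore := by
  refine ⟨fun a p q => ⟨rfl, ?_⟩, reach_e5⟩
  obtain ⟨h', -⟩ := (L.anSinkSystem Hplus Hts hpush hoverPlus hoverTS hreflPlus hreflTS).family_η_of_mem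
    (show (L.anSinkSystem Hplus Hts hpush hoverPlus hoverTS hreflPlus hreflTS).E (e5Emb.mapPath p) (e5Emb.mapPath q)
      from trivial)
  exact (DiagramOfCategories.HomotopyFamily.cast_E_iff _ _ p q).mpr h'

/-! ## `K` contains the embedded observables -/

include hpush hoverPlus hoverTS hreflPlus hreflTS in
/-- **`K` contains the embedded `S_log⊞_v`** (a boundary pair of `Hplus v` out of a base vertex is an inner member at `𝒩⊞_v`;
the diagonal pair at `𝒩⊞_v` is the identity on both sides). [cite: MochizukiAbsTopIII2015, Cor 5.5 (iii) p. 131] -/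
theorem compatibleInTelecorePlus (v : Vmod) (hobs : L.IsLogObservablePlus v (Hplus v)) :
    L.CompatibleInTelecorePlus anJ L.anTel (L.anObsFamily Hplus Hts hpush hoverPlus hoverTS hreflPlus hreflTS) v (Hplus v) := by
  intro a b p q h
  obtain rfl : b = (logShapePlus (isArc := isArc) v).obs := hobs.1 h
  suffices key : ∃ h' : (L.anObsFamily Hplus Hts hpush hoverPlus hoverTS hreflPlus hreflTS).E
      ((plusEmb (Vmod := Vmod) (isArc := isArc) v).mapPath p) ((plusEmb (Vmod := Vmod) (isArc := isArc) v).mapPath q),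
      HEq ((Hplus v).η h) ((L.anObsFamily Hplus Hts hpush hoverPlus hoverTS hreflPlus hreflTS).η h') by
    obtain ⟨h₁, e₁⟩ := key
    obtain ⟨h₂, e₂⟩ := mem_of_heq _ (embPlus_obj_eq v a).symm (embPlus_obj_eq v _).symm (embPlus_mapPath_heq v p).symm
      (embPlus_mapPath_heq v q).symm h₁
    exact ⟨h₂, e₁.trans e₂⟩
  rcases a with x | _
  · have mem : (L.plusComapAn v (Hplus v)).E p q := (L.plusComapAn_E_iff v (Hplus v) p q).mpr h
    obtain ⟨hE₀, e2⟩ := sinkη_ofMem (L := L) (hP := inFive_of_inTwo') (hxs := nplus_mem_five v) (plus_hnot v) x mem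
    have hE : (L.anSinkSystem Hplus Hts hpush hoverPlus hoverTS hreflPlus hreflTS).E
        ((plusEmb (Vmod := Vmod) (isArc := isArc) v).mapPath p) ((plusEmb (Vmod := Vmod) (isArc := isArc) v).mapPath q) := hE₀
    obtain ⟨h', e⟩ := (L.anSinkSystem Hplus Hts hpush hoverPlus hoverTS hreflPlus hreflTS).family_η_of_mem hE
    refine ⟨h', ?_⟩
    change HEq _ ((L.anSinkSystem Hplus Hts hpush hoverPlus hoverTS hreflPlus hreflTS).family.η h')
    rw [e]
    change HEq _ (L.sinkη (DVertex.InFirstRows 2) (.nplus v) inFive_of_inTwo' (nplus_mem_five v) (L.plusComapAn v (Hplus v)) hE₀)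
    rw [e2, LiftPair.hom_ofMem]
    exact ((DiagramOfCategories.HomotopyFamily.heq_eqToHom_comp_comp_eqToHom _ _ _).trans
      (L.plusComapAn_η_heq v (Hplus v) _)).symm
  · obtain ⟨-, hp⟩ := plusPath_from_obs v p
    obtain ⟨-, hq⟩ := plusPath_from_obs v q
    cases hp; cases hq
    refine ⟨⟨Chain₂.nil _⟩, ?_⟩
    rw [(Hplus v).η_refl h, (L.anObsFamily Hplus Hts hpush hoverPlus hoverTS hreflPlus hreflTS).η_refl]
    exact (heq_id_pathFunctor' (L.logDiagramPlus_eq_comapAlongAn v) _).trans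
      (heq_id_of_functor_eq (L.anDiagram.pathFunctor_comapAlong (plusEmb v) _))

include hpush hoverPlus hoverTS hreflPlus hreflTS in
/-- **`K` contains the embedded `S_log_v`**. [cite: MochizukiAbsTopIII2015, Cor 5.5 (iii) p. 131] -/
theorem compatibleInTelecoreTS (TS : L.TSHomotopies) (v : Vmod) (hobs : L.IsLogObservableTS TS v (Hts v)) :
    L.CompatibleInTelecoreTS anJ L.anTel (L.anObsFamily Hplus Hts hpush hoverPlus hoverTS hreflPlus hreflTS) v (Hts v) := by
  intro a b p q h
  obtain rfl : b = (logShapeTS (isArc := isArc) v).obs := hobs.1 h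
  suffices key : ∃ h' : (L.anObsFamily Hplus Hts hpush hoverPlus hoverTS hreflPlus hreflTS).E
      ((tsEmb (Vmod := Vmod) (isArc := isArc) v).mapPath p) ((tsEmb (Vmod := Vmod) (isArc := isArc) v).mapPath q),
      HEq ((Hts v).η h) ((L.anObsFamily Hplus Hts hpush hoverPlus hoverTS hreflPlus hreflTS).η h') by
    obtain ⟨h₁, e₁⟩ := key
    obtain ⟨h₂, e₂⟩ := mem_of_heq _ (embTS_obj_eq v a).symm (embTS_obj_eq v _).symm (embTS_mapPath_heq v p).symm
      (embTS_mapPath_heq v q).symm h₁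
    exact ⟨h₂, e₁.trans e₂⟩
  rcases a with x | _
  · have mem : (L.tsComapAn v (Hts v)).E p q := (L.tsComapAn_E_iff v (Hts v) p q).mpr h
    obtain ⟨hE₀, e2⟩ := sinkη_ofMem (L := L) (hP := inFive_of_inPortionThree' v) (hxs := nv_mem_five v) (ts_hnot v) x mem
    have hE : (L.anSinkSystem Hplus Hts hpush hoverPlus hoverTS hreflPlus hreflTS).E
        ((tsEmb (Vmod := Vmod) (isArc := isArc) v).mapPath p) ((tsEmb (Vmod := Vmod) (isArc := isArc) v).mapPath q) := hE₀
    obtain ⟨h', e⟩ := (L.anSinkSystem Hplus Hts hpush hoverPlus hoverTS hreflPlus hreflTS).family_η_of_mem hE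
    refine ⟨h', ?_⟩
    change HEq _ ((L.anSinkSystem Hplus Hts hpush hoverPlus hoverTS hreflPlus hreflTS).family.η h')
    rw [e]
    change HEq _ (L.sinkη (InPortionThree v) (.nv v) (inFive_of_inPortionThree' v) (nv_mem_five v) (L.tsComapAn v (Hts v)) hE₀)
    rw [e2, LiftPair.hom_ofMem]
    exact ((DiagramOfCategories.HomotopyFamily.heq_eqToHom_comp_comp_eqToHom _ _ _).trans
      (L.tsComapAn_η_heq v (Hts v) _)).symm
  · obtain ⟨-, hp⟩ := tsPath_from_obs v p
    obtain ⟨-, hq⟩ := tsPath_from_obs v q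
    cases hp; cases hq
    refine ⟨⟨Chain₂.nil _⟩, ?_⟩
    rw [(Hts v).η_refl h, (L.anObsFamily Hplus Hts hpush hoverPlus hoverTS hreflPlus hreflTS).η_refl]
    exact (heq_id_pathFunctor' (L.logDiagramTS_eq_comapAlongAn v) _).trans
      (heq_id_of_functor_eq (L.anDiagram.pathFunctor_comapAlong (tsEmb v) _))

/-! ## ★ Cor 5.5 (iii), last sentence, inside `D_{An•}` -/

include hpush hoverPlus hoverTS hreflPlus hreflTS in
/-- ★ **[AbsTopIII] Cor 5.5 (iii), last sentence, inside `D_{An•}` — SUFFICIENCY** (abc-iut-w5-d144's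
`Cor55ObservablesTelecoreCompatible`): for a setting with `V(F_mod) ≠ ∅` and observables `S_log⊞_v = Hplus v`, `S_log_v = Hts v`
at every `v` (`IsLogObservablePlus/TS`) such that `Hts v` contains `Hplus v` pushed along `𝒩⊞_v → 𝒩_v` (`hpush`), all their
homotopies read in `D_{An•}` lie over `Th•[Z]` (`hoverPlus`, `hoverTS`, for file 1's over-datum `anOverE`), and their boundary sets
contain the diagonal (`hreflPlus`, `hreflTS`), the telecore `𝔗_{An•}` of (ii) (file 1's `anTelecoreE`: edges `φ_⋏ = φ_{An•}` on the
nose), the core of (i) at `ℰ•` and the observables are COMPATIBLE: ONE family `K` on `D_{An•}` (the family of the sink system)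
contains `𝒥`, the embedded core family of `ℰ•`, and all the embedded `S_log⊞_v`, `S_log_v`.
[cite: MochizukiAbsTopIII2015, Cor 5.5 (iii) p. 131] -/
theorem cor55ObservablesTelecoreCompatible_of [Nonempty Vmod] (TS : L.TSHomotopies)
    (hobs : ∀ v : Vmod, L.IsLogObservablePlus v (Hplus v) ∧ L.IsLogObservableTS TS v (Hts v)) :
    L.Cor55ObservablesTelecoreCompatible TS := by
  refine ⟨_, _, L.anCoreObsE_isCore, L.anTelecoreE, rfl, HEq.rfl,
    L.e5Family (L.anObsFamily Hplus Hts hpush hoverPlus hoverTS hreflPlus hreflTS), L.e5Family_terminal _, Hplus, Hts,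
    L.anObsFamily Hplus Hts hpush hoverPlus hoverTS hreflPlus hreflTS,
    L.e5Family_isCore Hplus Hts hpush hoverPlus hoverTS hreflPlus hreflTS, hobs,
    L.anSubFamily_jfam Hplus Hts hpush hoverPlus hoverTS hreflPlus hreflTS, L.compatibleInTelecoreE5 _, fun v => ⟨?_, ?_⟩⟩
  · exact L.compatibleInTelecorePlus Hplus Hts hpush hoverPlus hoverTS hreflPlus hreflTS v (hobs v).1
  · exact L.compatibleInTelecoreTS Hplus Hts hpush hoverPlus hoverTS hreflPlus hreflTS TS v (hobs v).2

end Push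

end LogFrobeniusSetting

end Literature.AnabelianGeometry.AbsoluteAnabelian
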